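import Summits.ResolutionOfSingularities.ResolutionOfSingularities.Theorems.FrobeniusClosingPatchingRelPerfectDepthFlagCascade
import Summits.ResolutionOfSingularities.ResolutionOfSingularities.Theorems.FrobeniusLadderFInjectiveMacaulayficationProp44Assembly
import HarnessLib

/-!
# [OURS · L1 W5.2] TARGET (9b) `Cascade₂` — UNCONDITIONAL, by name from F-71

V. Cossart, O. Piltant, J. Algebra 320 (2008), Prop. 4.4 [cite: CossartPiltant2008, Prop. 4.4] is the tree theorem
`CP2008Prop44.cossartPiltant2008_prop44_holds` (F-71 assembly); `DepthTargets.cascade₂_of_prop44`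
(`…DepthFlagCascade`) turns it into the registered L1 W5.2 target `Cascade₂` (`…DepthFlagLegalTargets` :72).
This file is the three-line composition; nothing else is claimed. AI-written; weaker than expert review;
resolution in dimension ≥ 4 / characteristic `p` is NOT proved; no summit statement is proved.
-/

-- `Summit.<Summit>.<Sub>.Theorems` with `Sub = Summit` (single-conjunct summit, D-0017)
set_option linter.dupNamespace false

open Literature.AlgebraicGeometry.Resolution

namespace Summit.ResolutionOfSingularities.ResolutionOfSingularities.Theorems

universe u

namespace DepthTargets

/-- [OURS · L1 W5.2] **TARGET (9b) `Cascade₂`, unconditionally** — `cascade₂_of_prop44` applied to the F-71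
theorem `CP2008Prop44.cossartPiltant2008_prop44_holds`. [cite: CossartPiltant2008, Prop. 4.4] -/
theorem cascade₂_holds : Cascade₂.{u} :=
  cascade₂_of_prop44 CP2008Prop44.cossartPiltant2008_prop44_holds

end DepthTargets

end Summit.ResolutionOfSingularities.ResolutionOfSingularities.Theorems
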